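import Mathlib
import Literature.MathematicalPhysics.QuantumFieldTheory.Balaban1983to89.B6Eq291Generator
import Literature.MathematicalPhysics.QuantumFieldTheory.Balaban1983to89.B4RandomWalk213

/-!
# `Balaban1983to89.B6Eq2141Expansion` — T. Bałaban, *Propagators and renormalization transformations for lattice gauge
theories. II*, Commun. Math. Phys. **96** (1984) 223–250 [Balaban1984PropagatorsII], p. 247: the expansion **(2.141)**
`G = G₀(I − R)⁻¹ = Σ_{n≥0} G₀Rⁿ = Σ_ω h_{□₀}G_{□₀}h_{□₀}K_{□₁,□₂}G_{□₂}h_{□₂}·…·K_{□_{2n−1},□_{2n}}G_{□_{2n}}h_{□_{2n}}` of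
Proposition 2.6, PROVED as algebra + Neumann series from the generator identity (2.91), kernel-checked

statement-level skeleton of published theorems with citation tags; proofs where landed; nothing here is a claim about the Yang–Mills mass gap

CITATION HEADER (cell `lit-balaban`, HOME `run/shared/lean/pub/lit-balaban/`; unit `lit-balaban-r03` gen 5 = the B6
reader/fold owner; SKELETON row **B6.Prop2.6**, member (2.141); Phase-2 kind «knitting identity» (PHASE2-TARGETS §G.2(b));
TAKING line HOME/STATUS.md).  Source held: `paper:balaban1984-cmp96-propagators-rt-ii` (journal page = PDF page + 222);
p. 247 [PDF 25] re-read AS AN IMAGE (`run/shared/lean/pub/pub-balaban/b2b-balaban-ref1/pages/1984-cmp96-propagators-rt-II/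
1984-cmp96-propagators-rt-II-p025-x2.png`).  IMPORTED, NOT MODIFIED: `…B6Eq291Generator` (p02: (2.91) `eq291`, its `gZero` =
G₀ and `rOp` = R with the kernels `kFam` (2.92)–(2.93)), `…B4RandomWalk213` (b2b: ordered products `bprod`, the tuple
expansion `sum_pow_eq_sum_bprod`, `G_mul_one_sub_eq`, `hasSum_of_norm_lt_one`, `eq_of_mul_one_sub_eq`); the sibling
`…B6Eq250` does the same for the ONE-index expansion (2.50) of G′ and is not duplicated (here R is indexed by PAIRS (□, □′)).

WHAT THE PAPER PRINTS (p. 247, end of Proposition 2.6, verbatim): *"The operator G can be represented as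
G = G₀(I − R)^{−1} = Σ_{n=0}^{∞} G₀Rⁿ = Σ_{ω=(□₀,…,□_{2n})} h_{□₀}G_{□₀}h_{□₀} · K_{□₁,□₂}G_{□₂}h_{□₂} · … ·
K_{□_{2n−1},□_{2n}}G_{□_{2n}}h_{□_{2n}}, (2.141) and the series above is convergent in the norms appearing in the
inequalities (2.136)–(2.140)."*; p. 239: *"G₀ = Σ_{□∈𝒟} h_□G_□h_□ … Δ_aG₀ = I − Σ_{□,□′∈𝒟} K_{□,□′}G_{□′}h_{□′} = I − R, (2.91)"*.

WHAT IS PROVED HERE (0 `sorry`, 0 definitions, 0 named facts; axioms = the standard three).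
§1 IN ANY RING: from `GΔ_a = I` and (2.91) `Δ_aG₀ = I − R`: `G(I − R) = G₀` (`mul_one_sub_eq_gZero`); the ORDER-n TERM over all
   walks ω = (□₀; (□₁,□₂), …, (□_{2n−1},□_{2n})): `G₀Rⁿ = Σ_{□₀} Σ_{(□₁,□₂),…} h_{□₀}G_{□₀}h_{□₀}·Π_k K_{□_{2k−1},□_{2k}}G_{□_{2k}}h_{□_{2k}}`
   (`order_term_eq_sum_walks2141`: R is a sum over PAIRS, so the n-th power is the sum over n-tuples of pairs = the printed
   sequences of 2n+1 cubes) — the third member of (2.141) at each order.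
§2 IN ANY COMPLETE NORMED RING with ‖R‖ < 1 (the smallness the paper takes from (2.135), *"convergent in the norms
   (2.136)–(2.140)"* — here the HYPOTHESIS `hR`): `G = G₀(I − R)⁻¹` with `(I − R)⁻¹` the inverse of the unit `I − R`
   (`eq2141_units`, Mathlib `Units.oneSub`), `G = G₀Σ'_nRⁿ` (`eq2141_tsum`), the series CONVERGES TO G (`eq2141_hasSum`), and with
   the walk form of each term (`eq2141_walks`); uniqueness (`eq_of_291`: any G′ with G′(I − R) = G₀ is G).
§3 `eq2141_of_structure`: the same with (2.91) DISCHARGED by `B6Eq291Generator.eq291` from its printed structural hypotheses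
   ((2.36) Σh_□² = 1, Δ + Q*aQ = its T_□-version on supp h_□, Δ_{a,□}G_□ = I on supp h_□ (2.90), ζ_□ = 1 on supp h_□).
HONEST SCOPE.  Pure algebra + geometric series: the estimate ‖R‖ < 1 ((2.135) for M large) and the identification of the
norms are NOT proved here; nothing on d = 4 or the continuum; NOT summit progress.
-/

namespace Literature.MathematicalPhysics.QuantumFieldTheory.Balaban1983to89.B6Eq2141Expansion

open Finset
open B6Eq291Generator (gZero rOp kFam eq291)
open B4RandomWalk213 (bprod sum_pow_eq_sum_bprod G_mul_one_sub_eq hasSum_of_norm_lt_one eq_of_mul_one_sub_eq)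

/-! ## §1 The algebra of (2.141) in any ring -/

section Ring

variable {𝔄 : Type*} [Ring 𝔄] {ι : Type*} [Fintype ι] [DecidableEq ι]

/-- The factor of a pair `(□, □′)` in `R`: `K_{□,□′}G_{□′}h_{□′}` ((2.91)). [cite: Balaban1984PropagatorsII, (2.91) p.239] -/
theorem rOp_eq_sum_pairs (Dg : 𝔄) (h z g m p : ι → 𝔄) :
    rOp Finset.univ Dg h z g m p = ∑ q : ι × ι, kFam Dg h z m p q.1 q.2 * g q.2 * h q.2 := by
  unfold rOp
  exact (Fintype.sum_prod_type' (fun i j => kFam Dg h z m p i j * g j * h j)).symm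

omit [DecidableEq ι] in
/-- `G₀ = Σ_□ h_□G_□h_□` as a sum over the index type. [cite: Balaban1984PropagatorsII, (2.91) p.239] -/
theorem gZero_eq_sum (h g : ι → 𝔄) : gZero Finset.univ h g = ∑ i, h i * g i * h i := rfl

omit [Fintype ι] [DecidableEq ι] in
/-- **`G(I − R) = G₀`** from `GΔ_a = I` and (2.91) `Δ_aG₀ = I − R` — the algebra behind the first equality of (2.141).
[cite: Balaban1984PropagatorsII, (2.141) p.247] -/
theorem mul_one_sub_eq_gZero {G Da G0 R : 𝔄} (hG : G * Da = 1) (h291 : Da * G0 = 1 - R) : G * (1 - R) = G0 :=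
  G_mul_one_sub_eq hG h291

/-- **The third member of (2.141) at order n**: with `R = Σ_{(□,□′)} K_{□,□′}G_{□′}h_{□′}` a sum over PAIRS of cubes,
`G₀Rⁿ = Σ_{□₀} Σ_{((□₁,□₂),…,(□_{2n−1},□_{2n}))} h_{□₀}G_{□₀}h_{□₀} · K_{□₁,□₂}G_{□₂}h_{□₂} · … · K_{□_{2n−1},□_{2n}}G_{□_{2n}}h_{□_{2n}}`
— the sum over the printed sequences ω = (□₀, …, □_{2n}) (ordered product `bprod` of the pair factors).
[cite: Balaban1984PropagatorsII, (2.141) p.247] -/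
theorem order_term_eq_sum_walks2141 (Dg : 𝔄) (h z g m p : ι → 𝔄) (n : ℕ) :
    gZero Finset.univ h g * rOp Finset.univ Dg h z g m p ^ n =
      ∑ i, ∑ ys : Fin n → ι × ι,
        h i * g i * h i * bprod (fun q : ι × ι => kFam Dg h z m p q.1 q.2 * g q.2 * h q.2) n ys := by
  rw [gZero_eq_sum h g, rOp_eq_sum_pairs Dg h z g m p, sum_pow_eq_sum_bprod, Finset.sum_mul_sum]

end Ring

/-! ## §2 (2.141) in a complete normed ring of operators, ‖R‖ < 1 -/

section Normed

variable {𝔄 : Type*} [NormedRing 𝔄] [CompleteSpace 𝔄] {ι : Type*} [Fintype ι] [DecidableEq ι]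

omit [Fintype ι] [DecidableEq ι] in
/-- **(2.141), first equality: `G = G₀(I − R)⁻¹`** (the inverse of the unit `I − R`, ‖R‖ < 1), for `G` with `GΔ_a = I` and
(2.91). [cite: Balaban1984PropagatorsII, (2.141) p.247] -/
theorem eq2141_units {G Da G0 R : 𝔄} (hG : G * Da = 1) (h291 : Da * G0 = 1 - R) (hR : ‖R‖ < 1) :
    G = G0 * ↑(Units.oneSub R hR)⁻¹ := by
  have key : G * (Units.oneSub R hR : 𝔄) = G0 := by
    rw [Units.val_oneSub]
    exact mul_one_sub_eq_gZero hG h291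
  rw [← key, Units.mul_inv_cancel_right]

omit [Fintype ι] [DecidableEq ι] in
/-- **(2.141), second equality: the series `Σ_n G₀Rⁿ` CONVERGES TO `G`** (‖R‖ < 1). [cite: Balaban1984PropagatorsII, (2.141) p.247] -/
theorem eq2141_hasSum {G Da G0 R : 𝔄} (hG : G * Da = 1) (h291 : Da * G0 = 1 - R) (hR : ‖R‖ < 1) :
    HasSum (fun n : ℕ => G0 * R ^ n) G :=
  hasSum_of_norm_lt_one hR (mul_one_sub_eq_gZero hG h291)

omit [Fintype ι] [DecidableEq ι] in
/-- `G = G₀Σ'_nRⁿ`. [cite: Balaban1984PropagatorsII, (2.141) p.247] -/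
theorem eq2141_tsum {G Da G0 R : 𝔄} (hG : G * Da = 1) (h291 : Da * G0 = 1 - R) (hR : ‖R‖ < 1) :
    G = G0 * ∑' n : ℕ, R ^ n := by
  rw [← (eq2141_hasSum hG h291 hR).tsum_eq]
  exact (summable_geometric_of_norm_lt_one hR).tsum_mul_left G0

omit [Fintype ι] [DecidableEq ι] in
/-- The series is a RIGHT INVERSE of `Δ_a` outright: `Δ_a(G₀Σ'_nRⁿ) = (I − R)Σ'_nRⁿ = I` (no a-priori inverse of `Δ_a`).
[cite: Balaban1984PropagatorsII, (2.141) p.247] -/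
theorem series_right_inverse {Da G0 R : 𝔄} (h291 : Da * G0 = 1 - R) (hR : ‖R‖ < 1) :
    Da * (G0 * ∑' n : ℕ, R ^ n) = 1 := by
  rw [← mul_assoc, h291, mul_neg_geom_series _ hR]

omit [Fintype ι] [DecidableEq ι] in
/-- Uniqueness: with ‖R‖ < 1, `G(I − R) = G₀` determines `G`. [cite: Balaban1984PropagatorsII, (2.141) p.247] -/
theorem eq_of_291 {G G' Da G0 R : 𝔄} (hG : G * Da = 1) (h291 : Da * G0 = 1 - R) (hR : ‖R‖ < 1)
    (hG' : G' * (1 - R) = G0) : G' = G :=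
  eq_of_mul_one_sub_eq hR hG' (mul_one_sub_eq_gZero hG h291)

/-- **(2.141) in full for the concrete `G₀`, `R` of (2.91)**: `Σ_n Σ_ω h_{□₀}G_{□₀}h_{□₀}·Π K G h` converges to `G`, where the
n-th term is the sum over the sequences ω = (□₀, …, □_{2n}); hypotheses `GΔ_a = I`, (2.91) as an identity (`h291`), ‖R‖ < 1.
[cite: Balaban1984PropagatorsII, (2.141) p.247] -/
theorem eq2141_walks {G Da : 𝔄} (Dg : 𝔄) (h z g m p : ι → 𝔄) (hG : G * Da = 1)
    (h291 : Da * gZero Finset.univ h g = 1 - rOp Finset.univ Dg h z g m p)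
    (hR : ‖rOp Finset.univ Dg h z g m p‖ < 1) :
    HasSum (fun n : ℕ => ∑ i, ∑ ys : Fin n → ι × ι,
        h i * g i * h i * bprod (fun q : ι × ι => kFam Dg h z m p q.1 q.2 * g q.2 * h q.2) n ys) G := by
  have hs := eq2141_hasSum hG h291 hR
  refine hs.congr_fun fun n => ?_
  exact (order_term_eq_sum_walks2141 Dg h z g m p n).symm

/-! ## §3 With (2.91) discharged from its printed structure (`B6Eq291Generator.eq291`) -/

/-- **(2.141) from the printed structure of Sect. C**: in a complete normed ring of operators, if `G(Δ_a) = I` with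
`Δ_a = M − ∂P∂*` (`M` = Δ + Q*aQ, `Dg` = ∂P∂*), the cover satisfies Σ_□h_□² = 1 (2.36), `M` agrees with its T_□-version `m_□`
on supp h_□, `Δ_{a,□}G_□ = I` on supp h_□ (2.90) and ζ_□ = 1 on supp h_□, and ‖R‖ < 1, then
`G = G₀(I − R)⁻¹`, and `Σ_n Σ_ω h_{□₀}G_{□₀}h_{□₀}·K_{□₁,□₂}G_{□₂}h_{□₂}·…` converges to `G`.
[cite: Balaban1984PropagatorsII, (2.141) p.247] -/
theorem eq2141_of_structure {G : 𝔄} (M Dg : 𝔄) (h z g m p : ι → 𝔄) (hG : G * (M - Dg) = 1)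
    (hpart : ∑ i, h i * h i = 1) (hagree : ∀ i, M * h i = m i * h i)
    (hinv : ∀ i, (m i - p i) * g i * h i = h i) (hzh : ∀ i, z i * h i = h i) (hhz : ∀ i, h i * z i = h i)
    (hR : ‖rOp Finset.univ Dg h z g m p‖ < 1) :
    G = gZero Finset.univ h g * ↑(Units.oneSub (rOp Finset.univ Dg h z g m p) hR)⁻¹ ∧
      HasSum (fun n : ℕ => ∑ i, ∑ ys : Fin n → ι × ι,
        h i * g i * h i * bprod (fun q : ι × ι => kFam Dg h z m p q.1 q.2 * g q.2 * h q.2) n ys) G := by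
  have h291 : (M - Dg) * gZero Finset.univ h g = 1 - rOp Finset.univ Dg h z g m p :=
    eq291 Finset.univ M Dg h z g m p (by simpa using hpart) (fun i _ => hagree i) (fun i _ => hinv i)
      (fun i _ => hzh i) (fun i _ => hhz i)
  exact ⟨eq2141_units hG h291 hR, eq2141_walks Dg h z g m p hG h291 hR⟩

end Normed

end Literature.MathematicalPhysics.QuantumFieldTheory.Balaban1983to89.B6Eq2141Expansion
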